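import Mathlib
import HarnessLib
import Summits.HubbardSuperconductivity.HubbardSuperconductivity.Theorems.AposterioriCapRgSsbToEvenTorusLroDoubleCommBound
import Summits.HubbardSuperconductivity.HubbardSuperconductivity.Theorems.ThermalWedgeTwApproximatingHamiltonianLocality

/-!
# Route `EnslavedA1g`, support `EnslavedA1gUpperSandwich` (item `stmt-HubbardSuperconductivity-0938`):
# locality bounds for pair-field commutators on the torus (helper file 4/5)

The two `O(L²)` inputs of the Koma–Tasaki step of the upper sandwich, for the pair field
`Δ_g = pairField g L` and `H = hubbardTorus 2 L 1 U` on the torus `(ℤ/Lℤ)²`, in the quadratic-form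
shape consumed by the closing file (unit `ψ`, constants independent of `L`):

* `exists_commutator_pairField_bound` — `|⟨ψ, (Δ_g Δ_g† - Δ_g† Δ_g) ψ⟩| ≤ c_g L²`;
* `exists_doubleCommutator_pairField_bound` — `|⟨ψ, (Δ_g† [H, Δ_g] - [H, Δ_g] Δ_g†) ψ⟩| ≤ d_g(U) L²`.

Both are corollaries of graded-locality operator-norm bounds already in the tree:
`twAhm_norm_comm_pairField_conjTranspose_le` (`‖[Δ_g, Δ_g†]‖ ≤ 25 · 2‖P‖² · L²`, route ThermalWedge)
and `dcq_norm_doubleCommutator_pairFieldAt_le` at momentum `0`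
(`‖Δ_g†[Δ_g, K] - [Δ_g, K]Δ_g†‖ ≤ 36 s²(s+2) ‖P‖² (2|t|+|U|+2|μ|) L²`, crux `SsbToEvenTorusLro`),
converted by `|Re⟨ψ, Dψ⟩| ≤ ‖D‖ ⟨ψ, ψ⟩` (`Matrix.abs_re_star_dotProduct_mulVec_le`). The abstract
bookkeeping of the companion file `EnslavedA1gUpperSandwichLocalityAbstract` is an alternative
route to the same bounds and is not needed here.

Sources: T. Koma, H. Tasaki, J. Stat. Phys. 76 (1994) 745, proof of Thm 2.2; O. Bratteli,
D. W. Robinson, *Operator Algebras and QSM II* §5.2.2. Folklore bookkeeping.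
-/

noncomputable section

-- the mandated namespace `Summit.<Summit>.<Problem>.Theorems` repeats `HubbardSuperconductivity`
set_option linter.dupNamespace false

namespace Summit.HubbardSuperconductivity.HubbardSuperconductivity.Theorems.EnslavedA1g.UpperSandwich

open Matrix Finset
open Literature.Probability.LatticeModels Literature.MathematicalPhysics.QuantumLattice
open scoped ComplexOrder Matrix.Norms.L2Operator

/-- **`|⟨ψ, (Δ_g Δ_g† - Δ_g† Δ_g) ψ⟩| ≤ c_g L²`** for unit `ψ`, uniformly in `L` — the commutator of
the pair field with its adjoint is a translation sum of `O(1)`-many bounded local terms per site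
(`twAhm_norm_comm_pairField_conjTranspose_le`). Koma–Tasaki, J. Stat. Phys. 76 (1994) 745. [folklore] -/
theorem exists_commutator_pairField_bound (g : Site 2 → ℝ) :
    ∃ c : ℝ, 0 ≤ c ∧ ∀ (L : ℕ) [NeZero L] (ψ : Fock (Orb (FermionTorus 2 L))), star ψ ⬝ᵥ ψ = 1 →
      |(star ψ ⬝ᵥ ((pairField g L * (pairField g L)ᴴ - (pairField g L)ᴴ * pairField g L) *ᵥ ψ)).re| ≤
        c * (L : ℝ) ^ 2 := by
  refine ⟨25 * (2 * (2 * ∑ e ∈ insert (0 : Site 2) unitSteps, |g e / Real.sqrt 2|) ^ 2),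
    by positivity, fun L _ ψ hψ => ?_⟩
  have hnorm := twAhm_norm_comm_pairField_conjTranspose_le L g
  have hray := Matrix.abs_re_star_dotProduct_mulVec_le
    (pairField g L * (pairField g L)ᴴ - (pairField g L)ᴴ * pairField g L) ψ
  rw [hψ, Complex.one_re, mul_one] at hray
  exact hray.trans hnorm

/-- **`|⟨ψ, (Δ_g† [H, Δ_g] - [H, Δ_g] Δ_g†) ψ⟩| ≤ d_g(U) L²`** for unit `ψ`, uniformly in `L`, with
`H = hubbardTorus 2 L 1 U` — the Koma–Tasaki double commutator of the pair field with the Hubbard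
Hamiltonian is a sum of `O(L²)` bounded local terms (`dcq_norm_doubleCommutator_pairFieldAt_le` at
momentum `0`, `t = 1`, `μ = 0`; the registered orientation `Δ†[H,Δ] - [H,Δ]Δ†` is minus that of
the tree lemma). Koma–Tasaki, J. Stat. Phys. 76 (1994) 745, proof of Thm 2.2. [folklore] -/
theorem exists_doubleCommutator_pairField_bound (g : Site 2 → ℝ) (U : ℝ) :
    ∃ d : ℝ, 0 ≤ d ∧ ∀ (L : ℕ) [NeZero L] (ψ : Fock (Orb (FermionTorus 2 L))), star ψ ⬝ᵥ ψ = 1 →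
      |(star ψ ⬝ᵥ (((pairField g L)ᴴ *
          (hubbardTorus 2 L 1 U * pairField g L - pairField g L * hubbardTorus 2 L 1 U) -
        (hubbardTorus 2 L 1 U * pairField g L - pairField g L * hubbardTorus 2 L 1 U) *
          (pairField g L)ᴴ) *ᵥ ψ)).re| ≤ d * (L : ℝ) ^ 2 := by
  refine ⟨36 * ((insert (0 : Site 2) unitSteps).card : ℝ) ^ 2 *
      ((insert (0 : Site 2) unitSteps).card + 2) *
      (2 * ∑ e ∈ insert (0 : Site 2) unitSteps, |g e / Real.sqrt 2|) ^ 2 *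
      (2 * |(1 : ℝ)| + |U| + 2 * |(0 : ℝ)|), by positivity, fun L _ ψ hψ => ?_⟩
  set A := pairField g L with hA
  set H := hubbardTorus 2 L 1 U with hH
  -- the registered orientation is minus the tree lemma's
  have hflip : Aᴴ * (H * A - A * H) - (H * A - A * H) * Aᴴ =
      -(Aᴴ * (A * H - H * A) - (A * H - H * A) * Aᴴ) := by
    rw [← neg_sub (A * H) (H * A), mul_neg, neg_mul, neg_sub_neg, neg_sub]
  have hnorm : ‖Aᴴ * (H * A - A * H) - (H * A - A * H) * Aᴴ‖ ≤
      36 * ((insert (0 : Site 2) unitSteps).card : ℝ) ^ 2 *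
        ((insert (0 : Site 2) unitSteps).card + 2) *
        (2 * ∑ e ∈ insert (0 : Site 2) unitSteps, |g e / Real.sqrt 2|) ^ 2 *
        (2 * |(1 : ℝ)| + |U| + 2 * |(0 : ℝ)|) * (L : ℝ) ^ 2 := by
    rw [hflip, norm_neg]
    have h := dcq_norm_doubleCommutator_pairFieldAt_le g L 1 U 0 (0 : TorusSite 2 L)
    rwa [pairFieldAt_zero, hubbardTorusWith_zero] at h
  have hray := Matrix.abs_re_star_dotProduct_mulVec_le
    (Aᴴ * (H * A - A * H) - (H * A - A * H) * Aᴴ) ψ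
  rw [hψ, Complex.one_re, mul_one] at hray
  exact hray.trans hnorm

end Summit.HubbardSuperconductivity.HubbardSuperconductivity.Theorems.EnslavedA1g.UpperSandwich
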